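import Mathlib
import Literature.MathematicalPhysics.QuantumLattice.WilsonDiracAP
import Summits.QuantumFields.QCD.Theorems.QuarksAsStableActionCriticalLineDiamagnetismStubBlockHessianFormula
import Summits.QuantumFields.QCD.Theorems.WilsonQuarkChessboardFlatCellOptimalStubBlockHessianFormulaAuxAllN
import Summits.QuantumFields.QCD.Theorems.WilsonQuarkChessboardFlatCellOptimalStubBlockHessianFormulaAuxBAllN

/-!
# The block Hessian of the free Wilson–Dirac determinant in momentum space, `N` colours
(helper for crux stmt-QuantumFields-9307 `FlatCellOptimal`, line `registered`, stub
`stub_hessianMarginAllN`, sub-goal `stub_blockHessianFormulaAllN` — the `Fin 3 ↦ Fin N` port of the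
sibling crux stmt-QuantumFields-9734's `…CriticalLineDiamagnetismStubBlockHessianFormula`, gap G2a, wave 5)

What.  On the `2⁴` block `(ℤ/2)⁴` (colour `Fin N`, ANY `N : ℕ`, spin `Fin 4`) with constant central link
phases `u_μ = e^{iθ_μ}·1 ∈ U(N)`, free `r = 1` Wilson–Dirac operator `B⁰` and hopping perturbation `Δ(Y)`,
the one-loop block Hessian `Q_θ(Y) = ½ Re tr (B⁰⁻¹ΔY B⁰⁻¹ΔY) − ½ Re tr (B⁰⁻¹Δ(Y⋆Y))` of an
anti-Hermitian link field `Y : Edge 4 2 → M_N(ℂ)` is the explicit momentum-space quadratic form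
`Q_θ(Y) = (1/256) Σ_s Σ_{μν} H_θ(s)_{μν} Re tr (Ŷ_μ(s)ᴴ Ŷ_ν(s))`, `Ŷ_μ(s) = Σ_x (−1)^{s·x} Y(x,μ)` the
Walsh transform, with the `N`-FREE kernel `H = ½ X δ_{μν} + ½ Re B`: the tadpole
`X_μ = Σ_{s'} 4(sin² P_μ − M_W cos P_μ)/h` and the bubble `B_{μν}(s) = Σ_{s'} tr (S(P) V_ν(P+q, q) S(P+q) V_μ(P, q))`,
`P = θ + πs'`, `q = πs`, `S(P) = (M_W − iγ·sin P)/h` the free propagator and `V` the `r = 1` vertices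
(`stub_blockHessianFormulaAllN`, abstract form `BlockHessianFormula.blockHessian_eq`; the sibling's
`stub_blockHessianFormula` is the case `N = 3`).  The statement is the sibling's with `Fin 3 ↦ Fin N` and
with the `let`s `B0, Dl, Mw, h, S, V, mom, qv, H, chi, Yh` turned into universally quantified variables with
defining equations, so that the registered signature contains no `:=`; the block Hessian of a field in ONE
colour component is the `N = 1` complex-scalar form, and the kernel `H_θ(s)` does not depend on `N`.

How.  `BlockHessianFormula.trace_formulas` (`…StubBlockHessianFormulaAuxAllN`: `B⁰⁻¹ = P·blockdiag(1_N ⊗ S)·Pᴴ`,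
traces as sums over the 16 block momenta) and `BlockHessianFormula.hat_hop`
(`…StubBlockHessianFormulaAuxBAllN`: the momentum blocks of `Δ(E)`); for anti-Hermitian `Y` the blocks are
`Σ_ν Ŷ_ν(k+k') ⊗ Ṽ_ν(k,k')` (`hat_hop_antiHerm`), the Kronecker traces factor into colour × spin traces,
`tr (Ŷ_ν Ŷ_μ) = −tr (Ŷ_μᴴ Ŷ_ν)` is real (`trace_mul_of_antiHerm`), the double momentum sum is re-indexed
by the Walsh transfer `s = k + k'` (`sum_reindex`), and the vertices/propagators at `θ + π(s'+s)` are those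
at `θ + πs' + πs` (`2π`-periodicity in the representatives: the colour-free `symbolInv_periodic`,
`vertex_out`, `vertex_in` of the sibling file, re-EXPORTED here as aliases); the tadpole uses `parseval` and
the spin trace `trace_symbolInv_mul_hop`.  The proofs are the sibling's verbatim with `Fin 3 ↦ Fin N`.

References: Montvay–Münster, *Quantum Fields on a Lattice* §4.2 (free Wilson fermions and the hopping
expansion in momentum space); folklore.  Pure theorem file (no `def`s).
-/

noncomputable section

open scoped BigOperators Classical Matrix ComplexConjugate
open Finset
open Literature.MathematicalPhysics.QuantumLattice Literature.MathematicalPhysics.QuantumFieldTheory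
  Literature.Probability.LatticeModels

namespace Summit.QuantumFields.QCD.Cruxes.FlatCellOptimal.BlockHessian

open scoped Kronecker
open Complex (I)

namespace BlockHessianFormula

/-! ### The colour-free lemmas of the sibling file, re-exported under the same names (aliases) -/

export Summit.QuantumFields.QCD.Cruxes.CriticalLineDiamagnetism.ChessboardCellGain.BlockHessianFormula
  (symbolInv_periodic vertex_out vertex_in)

/-! ### Walsh transforms of anti-Hermitian fields -/

/-- For an anti-Hermitian `N × N`-matrix-valued link field `Y` the Walsh transforms `Ŷ_ν(s)` are
anti-Hermitian. -/
theorem walsh_antiHerm {N : ℕ} (chi : (Fin 4 → ZMod 2) → TorusSite 4 2 → ℝ)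
    (Yh : (Edge 4 2 → Matrix (Fin N) (Fin N) ℂ) → (Fin 4 → ZMod 2) → Fin 4 → Matrix (Fin N) (Fin N) ℂ)
    (Y : Edge 4 2 → Matrix (Fin N) (Fin N) ℂ) (hYh : ∀ E s μ, Yh E s μ = ∑ x, ((chi s x : ℝ) : ℂ) • E (x, μ))
    (hY : ∀ e, (Y e)ᴴ = -Y e) (s : Fin 4 → ZMod 2) (ν : Fin 4) : (Yh Y s ν)ᴴ = -Yh Y s ν := by
  -- adapted from the sibling's `BlockHessianFormula.walsh_antiHerm` (`Fin 3 ↦ Fin N`)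
  rw [hYh, Matrix.conjTranspose_sum, ← Finset.sum_neg_distrib]
  refine Finset.sum_congr rfl fun x _ => ?_
  rw [Matrix.conjTranspose_smul, hY, smul_neg, Complex.star_def, Complex.conj_ofReal]

/-! ### The blocks of `Δ(Y)` and `Δ(Y⋆Y)` for anti-Hermitian `Y`, `N` colours -/

section Main

variable {N : ℕ} (m : ℝ) (θ : Fin 4 → ℝ) (u : Fin 4 → Matrix.unitaryGroup (Fin N) ℂ)
  (B0 : Matrix (TorusSite 4 2 × Fin N × Fin 4) (TorusSite 4 2 × Fin N × Fin 4) ℂ)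
  (Dl : (Edge 4 2 → Matrix (Fin N) (Fin N) ℂ) →
    Matrix (TorusSite 4 2 × Fin N × Fin 4) (TorusSite 4 2 × Fin N × Fin 4) ℂ)
  (Mw h : (Fin 4 → ℝ) → ℝ) (S : (Fin 4 → ℝ) → Matrix (Fin 4) (Fin 4) ℂ)
  (V : (Fin 4 → ℝ) → (Fin 4 → ℝ) → Fin 4 → Matrix (Fin 4) (Fin 4) ℂ)
  (mom qv : (Fin 4 → ZMod 2) → Fin 4 → ℝ)
  (chi : (Fin 4 → ZMod 2) → TorusSite 4 2 → ℝ)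
  (Yh : (Edge 4 2 → Matrix (Fin N) (Fin N) ℂ) → (Fin 4 → ZMod 2) → Fin 4 → Matrix (Fin N) (Fin N) ℂ)
  (hat : Matrix (TorusSite 4 2 × Fin N × Fin 4) (TorusSite 4 2 × Fin N × Fin 4) ℂ →
    (Fin 4 → ZMod 2) → (Fin 4 → ZMod 2) → Matrix (Fin N × Fin 4) (Fin N × Fin 4) ℂ)
  (Y : Edge 4 2 → Matrix (Fin N) (Fin N) ℂ)

/-- **Blocks of `Δ(Y)` for anti-Hermitian `Y`** (`N` colours): `Δ̂(Y)(k,k') = Σ_ν Ŷ_ν(k+k') ⊗ Ṽ_ν(k,k')`,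
`Ṽ_ν(k,k') = −½ e^{iP_{k'}ν}(1 − γ_ν) + ½ e^{−iP_k ν}(1 + γ_ν)`. -/
theorem hat_hop_antiHerm
    (hu : ∀ μ, (u μ : Matrix (Fin N) (Fin N) ℂ) = Complex.exp (↑(θ μ) * I) • (1 : Matrix (Fin N) (Fin N) ℂ))
    (hDl : ∀ E, Dl E = Matrix.of fun p q : TorusSite 4 2 × Fin N × Fin 4 => -(1 / 2 : ℂ) * ∑ μ : Fin 4,
      ((if q.1 = Site.shift p.1 μ then ((1 : Matrix (Fin 4) (Fin 4) ℂ) - euclideanGamma μ) p.2.2 q.2.2 *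
          ((u μ : Matrix (Fin N) (Fin N) ℂ) * E (p.1, μ)) p.2.1 q.2.1 else 0) +
        (if p.1 = Site.shift q.1 μ then ((1 : Matrix (Fin 4) (Fin 4) ℂ) + euclideanGamma μ) p.2.2 q.2.2 *
          ((u μ : Matrix (Fin N) (Fin N) ℂ) * E (q.1, μ))ᴴ p.2.1 q.2.1 else 0)))
    (hmom : ∀ s κ, mom s κ = θ κ + Real.pi * ((s κ).val : ℝ))
    (hchi : ∀ s x, chi s x = (-1 : ℝ) ^ (∑ κ, (s κ).val * (x κ).val))
    (hYh : ∀ E s μ, Yh E s μ = ∑ x, ((chi s x : ℝ) : ℂ) • E (x, μ))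
    (hhat : ∀ A k k', hat A k k' =
      ∑ y, ∑ z, ((chi k y * chi k' z : ℝ) : ℂ) • Matrix.of fun c c' : Fin N × Fin 4 => A (y, c) (z, c'))
    (hY : ∀ e, (Y e)ᴴ = -Y e) (k k' : Fin 4 → ZMod 2) :
    hat (Dl Y) k k' = ∑ ν, Yh Y (k + k') ν ⊗ₖ
      ((-(1 / 2 : ℂ) * Complex.exp (↑(mom k' ν) * I)) • ((1 : Matrix (Fin 4) (Fin 4) ℂ) - euclideanGamma ν) +
        ((1 / 2 : ℂ) * Complex.exp (-(↑(mom k ν) * I))) • ((1 : Matrix (Fin 4) (Fin 4) ℂ) + euclideanGamma ν)) := by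
  -- adapted from the sibling's `BlockHessianFormula.hat_hop_antiHerm` (`Fin 3 ↦ Fin N`)
  have e2 : ∀ (A : Matrix (Fin N) (Fin N) ℂ) (b : ℂ) (G' : Matrix (Fin 4) (Fin 4) ℂ),
      b • ((-A) ⊗ₖ G') = (-b) • (A ⊗ₖ G') := fun A b G' => by
    rw [← neg_one_smul ℂ A, Matrix.smul_kronecker, smul_smul, mul_neg_one]
  rw [hat_hop θ u Dl mom chi Yh hat hu hDl hmom hchi hYh hhat Y k k']
  refine Finset.sum_congr rfl fun ν _ => ?_
  rw [walsh_antiHerm chi Yh Y hYh hY, e2, kron_smul_add]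
  congr 2
  ring

/-- **Diagonal blocks of `Δ(Y⋆Y)`** (`N` colours):
`Δ̂(Y⋆Y)(k,k) = Σ_ν Ẑ_ν ⊗ (−½ e^{iP_k ν}(1 − γ_ν) − ½ e^{−iP_k ν}(1 + γ_ν))`,
`Ẑ_ν = Σ_x Y(x,ν)²` the zero-momentum Walsh component (`Y⋆Y` is linkwise Hermitian). -/
theorem hat_hop_sq
    (hu : ∀ μ, (u μ : Matrix (Fin N) (Fin N) ℂ) = Complex.exp (↑(θ μ) * I) • (1 : Matrix (Fin N) (Fin N) ℂ))
    (hDl : ∀ E, Dl E = Matrix.of fun p q : TorusSite 4 2 × Fin N × Fin 4 => -(1 / 2 : ℂ) * ∑ μ : Fin 4,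
      ((if q.1 = Site.shift p.1 μ then ((1 : Matrix (Fin 4) (Fin 4) ℂ) - euclideanGamma μ) p.2.2 q.2.2 *
          ((u μ : Matrix (Fin N) (Fin N) ℂ) * E (p.1, μ)) p.2.1 q.2.1 else 0) +
        (if p.1 = Site.shift q.1 μ then ((1 : Matrix (Fin 4) (Fin 4) ℂ) + euclideanGamma μ) p.2.2 q.2.2 *
          ((u μ : Matrix (Fin N) (Fin N) ℂ) * E (q.1, μ))ᴴ p.2.1 q.2.1 else 0)))
    (hmom : ∀ s κ, mom s κ = θ κ + Real.pi * ((s κ).val : ℝ))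
    (hchi : ∀ s x, chi s x = (-1 : ℝ) ^ (∑ κ, (s κ).val * (x κ).val))
    (hYh : ∀ E s μ, Yh E s μ = ∑ x, ((chi s x : ℝ) : ℂ) • E (x, μ))
    (hhat : ∀ A k k', hat A k k' =
      ∑ y, ∑ z, ((chi k y * chi k' z : ℝ) : ℂ) • Matrix.of fun c c' : Fin N × Fin 4 => A (y, c) (z, c'))
    (hY : ∀ e, (Y e)ᴴ = -Y e) (k : Fin 4 → ZMod 2) :
    hat (Dl fun e => Y e * Y e) k k = ∑ ν, Yh (fun e => Y e * Y e) 0 ν ⊗ₖ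
      ((-(1 / 2 : ℂ) * Complex.exp (↑(mom k ν) * I)) • ((1 : Matrix (Fin 4) (Fin 4) ℂ) - euclideanGamma ν) +
        (-(1 / 2 : ℂ) * Complex.exp (-(↑(mom k ν) * I))) • ((1 : Matrix (Fin 4) (Fin 4) ℂ) + euclideanGamma ν)) := by
  -- adapted from the sibling's `BlockHessianFormula.hat_hop_sq` (`Fin 3 ↦ Fin N`)
  have hkk : k + k = 0 := by simpa only [add_zero] using add_add_cancel_left k 0
  have hherm : ∀ ν, (Yh (fun e => Y e * Y e) 0 ν)ᴴ = Yh (fun e => Y e * Y e) 0 ν := fun ν => by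
    simp only [hYh, Matrix.conjTranspose_sum, Matrix.conjTranspose_smul, Matrix.conjTranspose_mul, hY,
      neg_mul_neg, Complex.star_def, Complex.conj_ofReal]
  rw [hat_hop θ u Dl mom chi Yh hat hu hDl hmom hchi hYh hhat _ k k, hkk]
  refine Finset.sum_congr rfl fun ν _ => ?_
  rw [hherm, kron_smul_add]

/-! ### The two halves and the assembly, `N` colours -/

/-- **The bubble in momentum space** (`N` colours):
`½ Re tr (B⁰⁻¹ΔY B⁰⁻¹ΔY) = (1/256) Σ_{s,μ,ν} ½ Re B_{μν}(s) · Re tr (Ŷ_μ(s)ᴴ Ŷ_ν(s))`. -/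
theorem bubble_eq
    (hu : ∀ μ, (u μ : Matrix (Fin N) (Fin N) ℂ) = Complex.exp (↑(θ μ) * I) • (1 : Matrix (Fin N) (Fin N) ℂ))
    (hB0 : B0 = wilsonDirac (unitaryFundamentalRep (Fin N) ℂ) (fun e : Edge 4 2 => u e.2) m 1)
    (hDl : ∀ E, Dl E = Matrix.of fun p q : TorusSite 4 2 × Fin N × Fin 4 => -(1 / 2 : ℂ) * ∑ μ : Fin 4,
      ((if q.1 = Site.shift p.1 μ then ((1 : Matrix (Fin 4) (Fin 4) ℂ) - euclideanGamma μ) p.2.2 q.2.2 *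
          ((u μ : Matrix (Fin N) (Fin N) ℂ) * E (p.1, μ)) p.2.1 q.2.1 else 0) +
        (if p.1 = Site.shift q.1 μ then ((1 : Matrix (Fin 4) (Fin 4) ℂ) + euclideanGamma μ) p.2.2 q.2.2 *
          ((u μ : Matrix (Fin N) (Fin N) ℂ) * E (q.1, μ))ᴴ p.2.1 q.2.1 else 0)))
    (hMw : ∀ P, Mw P = m + ∑ κ, (1 - Real.cos (P κ)))
    (hh : ∀ P, h P = Mw P ^ 2 + ∑ κ, Real.sin (P κ) ^ 2)
    (hS : ∀ P, S P = ((h P)⁻¹ : ℂ) • (((Mw P : ℝ) : ℂ) • (1 : Matrix (Fin 4) (Fin 4) ℂ) -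
      I • ∑ κ, ((Real.sin (P κ) : ℝ) : ℂ) • euclideanGamma κ))
    (hV : ∀ P q μ, V P q μ = (-(1 / 2 : ℂ) * (Complex.exp (↑(P μ) * I) * I)) •
        ((1 : Matrix (Fin 4) (Fin 4) ℂ) - euclideanGamma μ) +
      (-(1 / 2 : ℂ) * (Complex.exp (-(↑(P μ + q μ) * I)) * (-I))) • ((1 : Matrix (Fin 4) (Fin 4) ℂ) + euclideanGamma μ))
    (hmom : ∀ s κ, mom s κ = θ κ + Real.pi * ((s κ).val : ℝ))
    (hqv : ∀ s κ, qv s κ = Real.pi * ((s κ).val : ℝ))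
    (hchi : ∀ s x, chi s x = (-1 : ℝ) ^ (∑ κ, (s κ).val * (x κ).val))
    (hYh : ∀ E s μ, Yh E s μ = ∑ x, ((chi s x : ℝ) : ℂ) • E (x, μ))
    (hpos : ∀ s, 0 < h (mom s)) (hY : ∀ e, (Y e)ᴴ = -Y e) :
    (B0⁻¹ * Dl Y * (B0⁻¹ * Dl Y)).trace.re / 2 = (1 / 256 : ℝ) * ∑ s, ∑ μ, ∑ ν,
      ((1 / 2 : ℝ) * (∑ s', (S (mom s') * V (mom s' + qv s) (qv s) ν * S (mom s' + qv s) *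
        V (mom s') (qv s) μ).trace).re) * ((Yh Y s μ)ᴴ * Yh Y s ν).trace.re := by
  -- adapted from the sibling's `BlockHessianFormula.bubble_eq` (`Fin 3 ↦ Fin N`)
  obtain ⟨hat, hhat⟩ : ∃ hat : Matrix (TorusSite 4 2 × Fin N × Fin 4) (TorusSite 4 2 × Fin N × Fin 4) ℂ →
      (Fin 4 → ZMod 2) → (Fin 4 → ZMod 2) → Matrix (Fin N × Fin 4) (Fin N × Fin 4) ℂ, ∀ A k k', hat A k k' =
        ∑ y, ∑ z, ((chi k y * chi k' z : ℝ) : ℂ) • Matrix.of fun c c' : Fin N × Fin 4 => A (y, c) (z, c') :=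
    ⟨_, fun _ _ _ => rfl⟩
  have hanti := walsh_antiHerm chi Yh Y hYh hY
  have hG : ∀ (s : Fin 4 → ZMod 2) (μ ν : Fin 4),
      (Yh Y s ν * Yh Y s μ).trace = -((Yh Y s μ)ᴴ * Yh Y s ν).trace := fun s μ ν => by
    rw [Matrix.trace_mul_comm, (trace_mul_of_antiHerm _ _ (hanti s μ) (hanti s ν)).1, neg_neg]
  have hGim : ∀ (s : Fin 4 → ZMod 2) (μ ν : Fin 4), (((Yh Y s μ)ᴴ * Yh Y s ν).trace).im = 0 := fun s μ ν => by
    rw [(trace_mul_of_antiHerm _ _ (hanti s μ) (hanti s ν)).1, Complex.neg_im,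
      (trace_mul_of_antiHerm _ _ (hanti s μ) (hanti s ν)).2, neg_zero]
  have hsc : ∀ G T : ℂ, -G * (-I * (-I * T)) = G * T := fun G T => by
    linear_combination (-G * T) * Complex.I_sq
  -- the summand at Walsh transfer `s` and loop momentum `s'`
  have hterm : ∀ s s' : Fin 4 → ZMod 2,
      ((1 : Matrix (Fin N) (Fin N) ℂ) ⊗ₖ S (mom s') * hat (Dl Y) s' (s' + s) *
        ((1 : Matrix (Fin N) (Fin N) ℂ) ⊗ₖ S (mom (s' + s)) * hat (Dl Y) (s' + s) s')).trace =
      ∑ μ, ∑ ν, ((Yh Y s μ)ᴴ * Yh Y s ν).trace *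
        (S (mom s') * V (mom s' + qv s) (qv s) ν * S (mom s' + qv s) * V (mom s') (qv s) μ).trace := by
    intro s s'
    rw [hat_hop_antiHerm θ u Dl mom chi Yh hat Y hu hDl hmom hchi hYh hhat hY,
      hat_hop_antiHerm θ u Dl mom chi Yh hat Y hu hDl hmom hchi hYh hhat hY, add_add_cancel_left,
      show s' + s + s' = s by rw [add_comm]; exact add_add_cancel_left s' s, trace_kron_two]
    refine Finset.sum_congr rfl fun μ _ => Finset.sum_congr rfl fun ν _ => ?_
    rw [vertex_out θ V mom qv hV hmom hqv, vertex_in θ V mom qv hV hmom hqv,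
      symbolInv_periodic m θ Mw h S mom qv hMw hh hS hmom hqv, hG]
    simp only [Matrix.mul_smul, Matrix.smul_mul, Matrix.trace_smul, smul_eq_mul, Matrix.mul_assoc]
    exact hsc _ _
  rw [(trace_formulas m θ u B0 Mw h S mom chi hat hu hB0 hMw hh hS hmom hchi hhat hpos).2 (Dl Y) (Dl Y),
    sum_reindex]
  simp only [hterm]
  exact re_bubble_bookkeeping _ _ hGim

/-- **The tadpole in momentum space** (`N` colours):
`½ Re tr (B⁰⁻¹Δ(Y⋆Y)) = −(1/256) Σ_{s,μ,ν} [μ = ν] ½ X_μ · Re tr (Ŷ_μ(s)ᴴ Ŷ_ν(s))`. -/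
theorem tadpole_eq
    (hu : ∀ μ, (u μ : Matrix (Fin N) (Fin N) ℂ) = Complex.exp (↑(θ μ) * I) • (1 : Matrix (Fin N) (Fin N) ℂ))
    (hB0 : B0 = wilsonDirac (unitaryFundamentalRep (Fin N) ℂ) (fun e : Edge 4 2 => u e.2) m 1)
    (hDl : ∀ E, Dl E = Matrix.of fun p q : TorusSite 4 2 × Fin N × Fin 4 => -(1 / 2 : ℂ) * ∑ μ : Fin 4,
      ((if q.1 = Site.shift p.1 μ then ((1 : Matrix (Fin 4) (Fin 4) ℂ) - euclideanGamma μ) p.2.2 q.2.2 *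
          ((u μ : Matrix (Fin N) (Fin N) ℂ) * E (p.1, μ)) p.2.1 q.2.1 else 0) +
        (if p.1 = Site.shift q.1 μ then ((1 : Matrix (Fin 4) (Fin 4) ℂ) + euclideanGamma μ) p.2.2 q.2.2 *
          ((u μ : Matrix (Fin N) (Fin N) ℂ) * E (q.1, μ))ᴴ p.2.1 q.2.1 else 0)))
    (hMw : ∀ P, Mw P = m + ∑ κ, (1 - Real.cos (P κ)))
    (hh : ∀ P, h P = Mw P ^ 2 + ∑ κ, Real.sin (P κ) ^ 2)
    (hS : ∀ P, S P = ((h P)⁻¹ : ℂ) • (((Mw P : ℝ) : ℂ) • (1 : Matrix (Fin 4) (Fin 4) ℂ) -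
      I • ∑ κ, ((Real.sin (P κ) : ℝ) : ℂ) • euclideanGamma κ))
    (hmom : ∀ s κ, mom s κ = θ κ + Real.pi * ((s κ).val : ℝ))
    (hchi : ∀ s x, chi s x = (-1 : ℝ) ^ (∑ κ, (s κ).val * (x κ).val))
    (hYh : ∀ E s μ, Yh E s μ = ∑ x, ((chi s x : ℝ) : ℂ) • E (x, μ))
    (hpos : ∀ s, 0 < h (mom s)) (hY : ∀ e, (Y e)ᴴ = -Y e) :
    (B0⁻¹ * Dl fun e => Y e * Y e).trace.re / 2 = -((1 / 256 : ℝ) * ∑ s, ∑ μ, ∑ ν,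
      (if μ = ν then (1 / 2 : ℝ) * ∑ s', 4 * (Real.sin (mom s' μ) ^ 2 - Mw (mom s') * Real.cos (mom s' μ)) /
        h (mom s') else 0) * ((Yh Y s μ)ᴴ * Yh Y s ν).trace.re) := by
  -- adapted from the sibling's `BlockHessianFormula.tadpole_eq` (`Fin 3 ↦ Fin N`)
  obtain ⟨hat, hhat⟩ : ∃ hat : Matrix (TorusSite 4 2 × Fin N × Fin 4) (TorusSite 4 2 × Fin N × Fin 4) ℂ →
      (Fin 4 → ZMod 2) → (Fin 4 → ZMod 2) → Matrix (Fin N × Fin 4) (Fin N × Fin 4) ℂ, ∀ A k k', hat A k k' =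
        ∑ y, ∑ z, ((chi k y * chi k' z : ℝ) : ℂ) • Matrix.of fun c c' : Fin N × Fin 4 => A (y, c) (z, c') :=
    ⟨_, fun _ _ _ => rfl⟩
  -- the spin traces
  have hX : ∀ (k : Fin 4 → ZMod 2) (ν : Fin 4), (S (mom k) *
      ((-(1 / 2 : ℂ) * Complex.exp (↑(mom k ν) * I)) • ((1 : Matrix (Fin 4) (Fin 4) ℂ) - euclideanGamma ν) +
        (-(1 / 2 : ℂ) * Complex.exp (-(↑(mom k ν) * I))) •
          ((1 : Matrix (Fin 4) (Fin 4) ℂ) + euclideanGamma ν))).trace =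
      ((4 * (Real.sin (mom k ν) ^ 2 - Mw (mom k) * Real.cos (mom k ν)) / h (mom k) : ℝ) : ℂ) := by
    intro k ν
    rw [hS]
    exact trace_symbolInv_mul_hop (Mw (mom k)) (h (mom k)) (mom k) ν
  -- the colour traces: Parseval and `tr (Y Y) = −tr (Yᴴ Y)`
  have hYY : ∀ e, (Y e * Y e).trace = -((Y e)ᴴ * Y e).trace := fun e => by
    rw [(trace_mul_of_antiHerm _ _ (hY e) (hY e)).1, neg_neg]
  have h0 : ∀ x : TorusSite 4 2, chi 0 x = 1 := fun x => by simp [hchi]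
  have hZ : ∀ μ, ∑ s, (((Yh Y s μ)ᴴ * Yh Y s μ).trace).re =
      -(16 * ((Yh (fun e => Y e * Y e) 0 μ).trace).re) := by
    intro μ
    rw [← Complex.re_sum, ← Matrix.trace_sum, parseval chi Yh hchi hYh Y μ, hYh,
      show (16 : ℂ) = ((16 : ℝ) : ℂ) by norm_num]
    simp only [h0, Complex.ofReal_one, one_smul, Matrix.trace_smul, Matrix.trace_sum, hYY,
      Finset.sum_neg_distrib, Complex.neg_re, smul_eq_mul, Complex.re_ofReal_mul]
    ring
  rw [(trace_formulas m θ u B0 Mw h S mom chi hat hu hB0 hMw hh hS hmom hchi hhat hpos).1]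
  simp only [hat_hop_sq θ u Dl mom chi Yh hat Y hu hDl hmom hchi hYh hhat hY, trace_kron_one, hX]
  exact re_tadpole_bookkeeping (fun k ν => 4 * (Real.sin (mom k ν) ^ 2 - Mw (mom k) * Real.cos (mom k ν)) / h (mom k))
    (fun ν => (Yh (fun e => Y e * Y e) 0 ν).trace) (fun s μ ν => ((Yh Y s μ)ᴴ * Yh Y s ν).trace) hZ

/-- **The block Hessian in momentum space, `N` colours** (abstract form of `stub_blockHessianFormulaAllN`). -/
theorem blockHessian_eq (H : (Fin 4 → ZMod 2) → Fin 4 → Fin 4 → ℝ)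
    (hu : ∀ μ, (u μ : Matrix (Fin N) (Fin N) ℂ) = Complex.exp (↑(θ μ) * I) • (1 : Matrix (Fin N) (Fin N) ℂ))
    (hB0 : B0 = wilsonDirac (unitaryFundamentalRep (Fin N) ℂ) (fun e : Edge 4 2 => u e.2) m 1)
    (hDl : ∀ E, Dl E = Matrix.of fun p q : TorusSite 4 2 × Fin N × Fin 4 => -(1 / 2 : ℂ) * ∑ μ : Fin 4,
      ((if q.1 = Site.shift p.1 μ then ((1 : Matrix (Fin 4) (Fin 4) ℂ) - euclideanGamma μ) p.2.2 q.2.2 *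
          ((u μ : Matrix (Fin N) (Fin N) ℂ) * E (p.1, μ)) p.2.1 q.2.1 else 0) +
        (if p.1 = Site.shift q.1 μ then ((1 : Matrix (Fin 4) (Fin 4) ℂ) + euclideanGamma μ) p.2.2 q.2.2 *
          ((u μ : Matrix (Fin N) (Fin N) ℂ) * E (q.1, μ))ᴴ p.2.1 q.2.1 else 0)))
    (hMw : ∀ P, Mw P = m + ∑ κ, (1 - Real.cos (P κ)))
    (hh : ∀ P, h P = Mw P ^ 2 + ∑ κ, Real.sin (P κ) ^ 2)
    (hS : ∀ P, S P = ((h P)⁻¹ : ℂ) • (((Mw P : ℝ) : ℂ) • (1 : Matrix (Fin 4) (Fin 4) ℂ) -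
      I • ∑ κ, ((Real.sin (P κ) : ℝ) : ℂ) • euclideanGamma κ))
    (hV : ∀ P q μ, V P q μ = (-(1 / 2 : ℂ) * (Complex.exp (↑(P μ) * I) * I)) •
        ((1 : Matrix (Fin 4) (Fin 4) ℂ) - euclideanGamma μ) +
      (-(1 / 2 : ℂ) * (Complex.exp (-(↑(P μ + q μ) * I)) * (-I))) • ((1 : Matrix (Fin 4) (Fin 4) ℂ) + euclideanGamma μ))
    (hmom : ∀ s κ, mom s κ = θ κ + Real.pi * ((s κ).val : ℝ))
    (hqv : ∀ s κ, qv s κ = Real.pi * ((s κ).val : ℝ))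
    (hH : ∀ s μ ν, H s μ ν = (if μ = ν then (1 / 2 : ℝ) * ∑ s' : Fin 4 → ZMod 2,
        4 * (Real.sin (mom s' μ) ^ 2 - Mw (mom s') * Real.cos (mom s' μ)) / h (mom s') else 0) +
      (1 / 2 : ℝ) * (∑ s' : Fin 4 → ZMod 2, (S (mom s') * V (mom s' + qv s) (qv s) ν * S (mom s' + qv s) *
        V (mom s') (qv s) μ).trace).re)
    (hchi : ∀ s x, chi s x = (-1 : ℝ) ^ (∑ κ, (s κ).val * (x κ).val))
    (hYh : ∀ E s μ, Yh E s μ = ∑ x, ((chi s x : ℝ) : ℂ) • E (x, μ))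
    (hpos : ∀ s, 0 < h (mom s)) (hY : ∀ e, (Y e)ᴴ = -Y e) :
    (B0⁻¹ * Dl Y * (B0⁻¹ * Dl Y)).trace.re / 2 - (B0⁻¹ * Dl (fun e => Y e * Y e)).trace.re / 2 =
      (1 / 256 : ℝ) * ∑ s, ∑ μ, ∑ ν, H s μ ν * ((Yh Y s μ)ᴴ * Yh Y s ν).trace.re := by
  -- adapted from the sibling's `BlockHessianFormula.blockHessian_eq` (`Fin 3 ↦ Fin N`)
  rw [bubble_eq m θ u B0 Dl Mw h S V mom qv chi Yh Y hu hB0 hDl hMw hh hS hV hmom hqv hchi hYh hpos hY,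
    tadpole_eq m θ u B0 Dl Mw h S mom chi Yh Y hu hB0 hDl hMw hh hS hmom hchi hYh hpos hY, sub_neg_eq_add]
  simp only [hH, add_mul, Finset.sum_add_distrib, mul_add]
  ring

end Main

end BlockHessianFormula

open BlockHessianFormula in
/-- **Sub-goal `stub_blockHessianFormulaAllN`** (the block Hessian in momentum space, `N` colours): on the
`2⁴` block with constant central phases `u_μ = e^{iθ_μ}·1 ∈ U(N)` (all `h(θ + πs) > 0`), for every
anti-Hermitian link field `Y : Edge 4 2 → M_N(ℂ)`,
`½ Re tr (B⁰⁻¹ΔY B⁰⁻¹ΔY) − ½ Re tr (B⁰⁻¹Δ(Y⋆Y)) = (1/256) Σ_s Σ_{μν} H_θ(s)_{μν} Re tr (Ŷ_μ(s)ᴴ Ŷ_ν(s))`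
with the `N`-free kernel `H = ½ X δ + ½ Re B` (tadpole `X_μ = Σ_{s'} 4(sin² P_μ − M_W cos P_μ)/h`, bubble
`B_{μν}(s) = Σ_{s'} tr (S(P) V_ν(P + q_s, q_s) S(P + q_s) V_μ(P, q_s))`, `P = θ + πs'`, `q_s = πs`;
`B0, Dl, Mw, h, S, V, mom, qv, H, chi, Yh` given by their defining equations). -/
theorem stub_blockHessianFormulaAllN : ∀ (N : ℕ) (m : ℝ) (θ : Fin 4 → ℝ) (u : Fin 4 → Matrix.unitaryGroup (Fin N) ℂ), (∀ μ, ((u μ : Matrix.unitaryGroup (Fin N) ℂ) : Matrix (Fin N) (Fin N) ℂ) = Complex.exp (↑(θ μ) * Complex.I) • (1 : Matrix (Fin N) (Fin N) ℂ)) → ∀ (B0 : Matrix (TorusSite 4 2 × Fin N × Fin 4) (TorusSite 4 2 × Fin N × Fin 4) ℂ) (Dl : (Edge 4 2 → Matrix (Fin N) (Fin N) ℂ) → Matrix (TorusSite 4 2 × Fin N × Fin 4) (TorusSite 4 2 × Fin N × Fin 4) ℂ) (Mw h : (Fin 4 → ℝ) → ℝ) (S : (Fin 4 → ℝ) → Matrix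 (Fin 4) (Fin 4) ℂ) (V : (Fin 4 → ℝ) → (Fin 4 → ℝ) → Fin 4 → Matrix (Fin 4) (Fin 4) ℂ) (mom qv : (Fin 4 → ZMod 2) → Fin 4 → ℝ) (H : (Fin 4 → ZMod 2) → Fin 4 → Fin 4 → ℝ) (chi : (Fin 4 → ZMod 2) → TorusSite 4 2 → ℝ) (Yh : (Edge 4 2 → Matrix (Fin N) (Fin N) ℂ) → (Fin 4 → ZMod 2) → Fin 4 → Matrix (Fin N) (Fin N) ℂ), B0 = wilsonDirac (unitaryFundamentalRep (Fin N) ℂ) (fun e : Edge 4 2 => u e.2) m 1 → (∀ E, Dl E = Matrix.of fun (p q : TorusSite 4 2 × Fin N × Fin 4) => -(1 / 2 : ℂ) * ∑ μ : Fin 4, ((if q.1 = Site.shift p.1 μ then ((1 : Matrix (Fin 4) (Fin 4) ℂ) - euclideanGamma μ) p.2.2 q.2.2 * (((u μ : Matrix.unitaryGroup (Fin N) ℂ) : Matrix (Fin N) (Fin N) ℂ) * E (p.1, μ)) p.2.1 q.2.1 else 0) + (if p.1 = Site.shift q.1 μ then ((1 : Matrix (Fin 4) (Fin 4) ℂ)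 + euclideanGamma μ) p.2.2 q.2.2 * (((u μ : Matrix.unitaryGroup (Fin N) ℂ) : Matrix (Fin N) (Fin N) ℂ) * E (q.1, μ))ᴴ p.2.1 q.2.1 else 0))) → (∀ P, Mw P = m + ∑ κ : Fin 4, (1 - Real.cos (P κ))) → (∀ P, h P = Mw P ^ 2 + ∑ κ : Fin 4, Real.sin (P κ) ^ 2) → (∀ P, S P = ((h P)⁻¹ : ℂ) • (((Mw P : ℝ) : ℂ) • (1 : Matrix (Fin 4) (Fin 4) ℂ) - Complex.I • ∑ κ : Fin 4, ((Real.sin (P κ) : ℝ) : ℂ) • euclideanGamma κ)) → (∀ P q μ, V P q μ = (-(1 / 2 : ℂ) * (Complex.exp (↑(P μ) * Complex.I) * Complex.I)) • ((1 : Matrix (Fin 4) (Fin 4) ℂ) - euclideanGamma μ) + (-(1 / 2 : ℂ) * (Complex.exp (-(↑(P μ + q μ) * Complex.I)) * (-Complex.I))) • ((1 : Matrix (Fin 4) (Fin 4) ℂ) + euclideanGamma μ)) → (∀ s κ, mom s κ = θ κ + Real.pi * ((s κ).val : ℝ)) → (∀ s κ, qv s κ = Real.pi * ((s κ).val : ℝ))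 → (∀ s μ ν, H s μ ν = (if μ = ν then (1 / 2 : ℝ) * ∑ s' : Fin 4 → ZMod 2, 4 * (Real.sin (mom s' μ) ^ 2 - Mw (mom s') * Real.cos (mom s' μ)) / h (mom s') else 0) + (1 / 2 : ℝ) * (∑ s' : Fin 4 → ZMod 2, (S (mom s') * V (mom s' + qv s) (qv s) ν * S (mom s' + qv s) * V (mom s') (qv s) μ).trace).re) → (∀ s x, chi s x = (-1 : ℝ) ^ (∑ κ : Fin 4, (s κ).val * (x κ).val)) → (∀ E s μ, Yh E s μ = ∑ x : TorusSite 4 2, ((chi s x : ℝ) : ℂ) • E (x, μ)) → (∀ s' : Fin 4 → ZMod 2, 0 < h (mom s')) → ∀ Y : Edge 4 2 → Matrix (Fin N) (Fin N) ℂ, (∀ e, (Y e)ᴴ = -Y e) → (B0⁻¹ * Dl Y * (B0⁻¹ * Dl Y)).trace.re / 2 - (B0⁻¹ * Dl (fun e => Y e * Y e)).trace.re / 2 = (1 / 256 : ℝ) * ∑ s : Fin 4 → ZMod 2, ∑ μ : Fin 4, ∑ ν : Fin 4, H s μ ν * ((Yh Y s μ)ᴴ * Yh Y s ν).trace.re :=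 by
  intro N m θ u hu B0 Dl Mw h S V mom qv H chi Yh hB0 hDl hMw hh hS hV hmom hqv hH hchi hYh hpos Y hY
  exact blockHessian_eq m θ u B0 Dl Mw h S V mom qv chi Yh Y H hu hB0 hDl hMw hh hS hV hmom hqv hH hchi hYh
    hpos hY

end Summit.QuantumFields.QCD.Cruxes.FlatCellOptimal.BlockHessian

end
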